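import Summits.HodgeConjecture.HodgeConjecture.Theorems.SignSymmetricPowersGenSingularFamilies
import Summits.HodgeConjecture.HodgeConjecture.Theorems.SignSymmetricPowersGenBlockTransit
import Summits.HodgeConjecture.HodgeConjecture.Theorems.SignSymmetricPowersMeridianPrimes
import HarnessLib

/-!
# K1-B meridian package, G2 part (i): COVERAGE — every prime factor of the restricted discriminant of the sign family
# vanishes at one of the three nodal witnesses (route `SignSymmetricPowers`, item stmt-HodgeConjecture-19716)

Helper file (`--supports stmt-HodgeConjecture-19716`); item ✗4 of prover-B's INDEX for the assembly of GEN
(`stub_signMeridianGeneration`): so that a `Meridian` can be centred at a witness for EVERY listed prime factor.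

Sign family: `n = 3`, `γ = (−1,−1,1,1,1)`, `M = {m | m₀ + m₁ even}` (= the monomials fixed by `γ`,
`mem_signMonomials_iff_unitWeight`).  A singular `M`-form has a singular point `z ≠ 0` of one of three TYPES: on
`Π = {x₀ = x₁ = 0}`, on `L = {x₂ = x₃ = x₄ = 0}`, or free; the block-diagonal invertible matrices (commuting with
`diagonal γ`) move `z` to the reference point `e₄`, `e₀`, `q = (1,0,1,0,0)` of its type
(`SignSymmetricPowersGenBlockTransit`), so the coefficient vector lies in the range of the corresponding ORBIT FAMILY
(`SignSymmetricPowersGenSingularFamilies`: irreducible, inside `V(D_M)`).  Prime avoidance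
(`SignSymmetricPowersMeridianPrimes.exists_span_singleton_eq_of_zeroLocus_subset`) then gives:

* `prime_factor_eval_witness_eq_zero` — for `M` the monomials fixed by `γ` (`mem_signMonomials_iff_unitWeight` for the
  parity set), `D_M = killHom Disc ≠ 0` (`singularCoeffs = V(Disc)`, `d ≥ 2`) and any
  irreducible `h ∣ D_M`, and ANY three `M`-supported degree-`d` forms `f₁, f₂, f₃` singular at `e₄`, `e₀`, `q`
  respectively: `h(coeff_M f₁) = 0 ∨ h(coeff_M f₂) = 0 ∨ h(coeff_M f₃) = 0`.

Sorry-free; axioms standard; no definition, no named fact.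

## References

* [GelfandKapranovZelevinsky1994] Gelfand–Kapranov–Zelevinsky, Discriminants…, Ch. 1 §1.
* [Hartshorne1977] R. Hartshorne, Algebraic Geometry, I Prop. 1.13, I Ex. 5.8.
-/

noncomputable section

set_option linter.dupNamespace false

open MvPolynomial Matrix
open Literature.AlgebraicGeometry.Motives Literature.AlgebraicGeometry.Motives.UniversalHypersurface
open Literature.AlgebraicGeometry.HodgeTheory
open Literature.Computability.AlgebraicComplexity
open Summit.HodgeConjecture.HodgeConjecture.Theorems.SignSymmetricPowersGenLinSubst
open Summit.HodgeConjecture.HodgeConjecture.Theorems.SignSymmetricPowersGenSingularFamilies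
open Summit.HodgeConjecture.HodgeConjecture.Theorems.SignSymmetricPowersGenBlockTransit
open Summit.HodgeConjecture.HodgeConjecture.Theorems.SignSymmetricPowersMeridianOneNode

namespace Summit.HodgeConjecture.HodgeConjecture.Theorems.SignSymmetricPowersGenCoverage

/-! ### §1 Generic: a spanning family of the invariant forms singular at `p`, and forms from coefficient vectors -/

section Generic

variable {n d : ℕ} (M : Set (DegIndex n d)) [DecidablePred (· ∈ M)]

/-- The form of a coefficient vector `a ∈ ℂ^M` (extended by zero) is `M`-supported. [cite: VoisinHodgeII2003, §6.2.1] -/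
theorem isSupportedOn_formOfCoeffs_extend (a : M → ℂ) :
    IsSupportedOn n d M (formOfCoeffs fun m : DegIndex n d => if h : m ∈ M then a ⟨m, h⟩ else 0) := by
  intro m hm
  rw [coeff_formOfCoeffs, dif_neg hm]

/-- Reading the `M`-coefficients of the form of `a` gives back `a`. [cite: VoisinHodgeII2003, §6.2.1] -/
theorem coeffM_formOfCoeffs_extend (a : M → ℂ) :
    (fun m' : M => coeff m'.1.1 (formOfCoeffs fun m : DegIndex n d => if h : m ∈ M then a ⟨m, h⟩ else 0)) = a := by
  funext m'
  rw [coeff_formOfCoeffs, dif_pos m'.2]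

/-- `a ↦ formOfCoeffs (ext a)` is additive. [folklore] -/
theorem formOfCoeffs_extend_add (a b : M → ℂ) :
    formOfCoeffs (fun m : DegIndex n d => if h : m ∈ M then (a + b) ⟨m, h⟩ else 0) =
      formOfCoeffs (fun m : DegIndex n d => if h : m ∈ M then a ⟨m, h⟩ else 0) +
        formOfCoeffs (fun m : DegIndex n d => if h : m ∈ M then b ⟨m, h⟩ else 0) := by
  rw [← formOfCoeffs_add]
  congr 1
  funext m
  by_cases hm : m ∈ M <;> simp [hm]

/-- `a ↦ formOfCoeffs (ext a)` is homogeneous. [folklore] -/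
theorem formOfCoeffs_extend_smul (c : ℂ) (a : M → ℂ) :
    formOfCoeffs (fun m : DegIndex n d => if h : m ∈ M then (c • a) ⟨m, h⟩ else 0) =
      c • formOfCoeffs (fun m : DegIndex n d => if h : m ∈ M then a ⟨m, h⟩ else 0) := by
  rw [← formOfCoeffs_smul]
  congr 1
  funext m
  by_cases hm : m ∈ M <;> simp [hm]

/-- **A finite spanning family of the `M`-supported degree-`d` forms singular at `p`** (a basis of the linear space
`{a ∈ ℂ^M | ∇(form of a)(p) = 0}`, read as forms). [folklore] -/
theorem exists_spanning_family (p : Fin (n + 2) → ℂ) :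
    ∃ (r : ℕ) (v : Fin r → MvPolynomial (Fin (n + 2)) ℂ),
      (∀ t, (v t).IsHomogeneous d) ∧ (∀ t, IsSupportedOn n d M (v t)) ∧
      (∀ t j, MvPolynomial.eval p (pderiv j (v t)) = 0) ∧
      ∀ F : MvPolynomial (Fin (n + 2)) ℂ, F.IsHomogeneous d → IsSupportedOn n d M F →
        (∀ j, MvPolynomial.eval p (pderiv j F) = 0) → ∃ b : Fin r → ℂ, F = ∑ t, b t • v t := by
  classical
  -- `a ↦ form of a`, as a linear map
  let ΦL : (M → ℂ) →ₗ[ℂ] MvPolynomial (Fin (n + 2)) ℂ :=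
    { toFun := fun a => formOfCoeffs fun m : DegIndex n d => if h : m ∈ M then a ⟨m, h⟩ else 0
      map_add' := formOfCoeffs_extend_add M
      map_smul' := formOfCoeffs_extend_smul M }
  have hΦL : ∀ a, ΦL a = formOfCoeffs (fun m : DegIndex n d => if h : m ∈ M then a ⟨m, h⟩ else 0) := fun a => rfl
  -- the gradient at `p`, as a linear map
  let gradL : MvPolynomial (Fin (n + 2)) ℂ →ₗ[ℂ] (Fin (n + 2) → ℂ) :=
    LinearMap.pi fun j => (MvPolynomial.aeval p).toLinearMap ∘ₗ (pderiv j).toLinearMap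
  have hgradL : ∀ F j, gradL F j = MvPolynomial.eval p (pderiv j F) := fun F j => by
    simp [gradL]
  let B : Submodule ℂ (M → ℂ) := LinearMap.ker (gradL ∘ₗ ΦL)
  have hmemB : ∀ a, a ∈ B ↔ ∀ j, MvPolynomial.eval p (pderiv j (ΦL a)) = 0 := by
    intro a
    rw [LinearMap.mem_ker, LinearMap.comp_apply]
    constructor
    · intro h j; rw [← hgradL]; rw [h]; rfl
    · intro h; funext j; rw [hgradL]; exact h j
  let bB := Module.finBasis ℂ B
  let v : Fin (Module.finrank ℂ B) → MvPolynomial (Fin (n + 2)) ℂ := fun t => ΦL ((bB t : B) : M → ℂ)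
  have hv : ∀ t, v t = formOfCoeffs (fun m : DegIndex n d => if h : m ∈ M then ((bB t : B) : M → ℂ) ⟨m, h⟩ else 0) :=
    fun t => rfl
  have h1 : ∀ t, (v t).IsHomogeneous d := fun t => by rw [hv]; exact isHomogeneous_formOfCoeffs _
  have h2 : ∀ t, IsSupportedOn n d M (v t) := fun t => by rw [hv]; exact isSupportedOn_formOfCoeffs_extend M _
  have h3 : ∀ t j, MvPolynomial.eval p (pderiv j (v t)) = 0 := fun t j => (hmemB _).mp (bB t).2 j
  have h4 : ∀ F : MvPolynomial (Fin (n + 2)) ℂ, F.IsHomogeneous d → IsSupportedOn n d M F →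
      (∀ j, MvPolynomial.eval p (pderiv j F) = 0) → ∃ b : Fin (Module.finrank ℂ B) → ℂ, F = ∑ t, b t • v t := by
    intro F hF hFM hFp
    -- `F = ΦL (coeff_M F)` with `coeff_M F ∈ B`
    set a : M → ℂ := fun m' : M => coeff m'.1.1 F with ha
    have hFa : ΦL a = F := by
      rw [hΦL, extend_coeffM_eq_coeffsOf n d M hFM, formOfCoeffs_coeffsOf n d hF]
    have haB : a ∈ B := (hmemB _).mpr fun j => by rw [hFa]; exact hFp j
    refine ⟨fun t => bB.repr ⟨a, haB⟩ t, ?_⟩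
    have hsum : (∑ t, bB.repr ⟨a, haB⟩ t • ((bB t : B) : M → ℂ)) = a := by
      have := congr_arg (Subtype.val : B → (M → ℂ)) (bB.sum_repr ⟨a, haB⟩)
      simpa only [AddSubmonoidClass.coe_finsetSum, SetLike.val_smul] using this
    have hlin : ΦL (∑ t, bB.repr ⟨a, haB⟩ t • ((bB t : B) : M → ℂ)) = ∑ t, bB.repr ⟨a, haB⟩ t • v t := by
      rw [map_sum]
      exact Finset.sum_congr rfl fun t _ => by rw [map_smul]
    rw [hsum, hFa] at hlin
    exact hlin
  exact ⟨Module.finrank ℂ B, v, h1, h2, h3, h4⟩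

end Generic

/-! ### §2 The sign family: `M` is the set of monomials fixed by `γ`; types of points -/

/-- For the sign involution `γ = (−1,−1,1,1,1)`: `γ^m = (−1)^{m₀+m₁}`, so `m` is fixed iff `m₀ + m₁` is even.
[cite: Katz2009, §3] -/
theorem mem_signMonomials_iff_unitWeight {d : ℕ} (m : DegIndex 3 d) :
    m ∈ {m : DegIndex 3 d | Even (m.1 0 + m.1 1)} ↔
      unitWeight ℂ 3 (fun i : Fin 5 => if (i : ℕ) < 2 then -1 else 1) m.1 = 1 := by
  have hw : unitWeight ℂ 3 (fun i : Fin 5 => if (i : ℕ) < 2 then -1 else 1) m.1 = (-1) ^ (m.1 0 + m.1 1) := by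
    unfold unitWeight
    rw [Finsupp.prod_fintype _ _ (fun i => pow_zero _), Fin.prod_univ_five]
    simp [pow_add]
  rw [Set.mem_setOf_eq, hw, neg_one_pow_eq_one_iff_even]
  norm_num [Units.ext_iff]

/-! ### §3 Coverage -/

/-- **Every prime factor of the restricted discriminant of the sign family vanishes at one of the three witnesses.**
Let `Disc` cut out `singularCoeffs 3 d` (`d ≥ 2`), `D_M = killHom Disc ≠ 0` on the ι-even coefficient space, `h` an
irreducible factor of `D_M`, and `f₁, f₂, f₃` ι-even degree-`d` forms singular at `e₄ = (0,0,0,0,1)`,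
`e₀ = (1,0,0,0,0)`, `q = (1,0,1,0,0)` respectively.  Then `h` vanishes at `coeff_M f₁`, `coeff_M f₂` or `coeff_M f₃`.
[cite: GelfandKapranovZelevinsky1994, Ch. 1 §1 (the discriminant hypersurface)] [cite: Hartshorne1977, I Prop. 1.13] -/
theorem prime_factor_eval_witness_eq_zero {d : ℕ} (hd : 2 ≤ d) (M : Set (DegIndex 3 d)) [DecidablePred (· ∈ M)]
    (hM : ∀ m : DegIndex 3 d, m ∈ M ↔ unitWeight ℂ 3 (fun i : Fin 5 => if (i : ℕ) < 2 then -1 else 1) m.1 = 1)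
    {Disc : MvPolynomial (DegIndex 3 d) ℂ}
    (hV : ∀ a : DegIndex 3 d → ℂ, a ∈ singularCoeffs 3 d ↔ MvPolynomial.eval a Disc = 0)
    (hD0 : killHom ℂ 3 d M Disc ≠ 0)
    {h : MvPolynomial M ℂ} (hh : Irreducible h) (hdvd : h ∣ killHom ℂ 3 d M Disc)
    {f₁ f₂ f₃ : MvPolynomial (Fin 5) ℂ} (hf₁ : f₁.IsHomogeneous d) (hf₂ : f₂.IsHomogeneous d) (hf₃ : f₃.IsHomogeneous d)
    (hM₁ : IsSupportedOn 3 d M f₁) (hM₂ : IsSupportedOn 3 d M f₂) (hM₃ : IsSupportedOn 3 d M f₃)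
    (h₁ : ∀ j, MvPolynomial.eval (![0, 0, 0, 0, 1] : Fin 5 → ℂ) (pderiv j f₁) = 0)
    (h₂ : ∀ j, MvPolynomial.eval (![1, 0, 0, 0, 0] : Fin 5 → ℂ) (pderiv j f₂) = 0)
    (h₃ : ∀ j, MvPolynomial.eval (![1, 0, 1, 0, 0] : Fin 5 → ℂ) (pderiv j f₃) = 0) :
    MvPolynomial.eval (fun m' : M => coeff m'.1.1 f₁) h = 0 ∨
    MvPolynomial.eval (fun m' : M => coeff m'.1.1 f₂) h = 0 ∨
    MvPolynomial.eval (fun m' : M => coeff m'.1.1 f₃) h = 0 := by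
  classical
  set γ : Fin 5 → ℂˣ := fun i : Fin 5 => if (i : ℕ) < 2 then -1 else 1 with hγdef
  have aeval_eq : ∀ (x : M → ℂ) (q : MvPolynomial M ℂ), MvPolynomial.aeval x q = MvPolynomial.eval x q :=
    fun x q => DFunLike.congr_fun (coe_aeval_eq_eval x) q
  have hγD : (Matrix.diagonal fun i : Fin 5 => (γ i : ℂ)) =
      Matrix.diagonal (fun l : Fin 5 => if (l : ℕ) < 2 then (-1 : ℂ) else 1) := by
    congr 1; funext i; rw [hγdef]; dsimp only; split_ifs <;> simp
  -- the three reference points and their spanning families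
  let pt : Fin 3 → (Fin 5 → ℂ) := ![![0, 0, 0, 0, 1], ![1, 0, 0, 0, 0], ![1, 0, 1, 0, 0]]
  have hpt : ∀ i, pt i ≠ 0 := by
    intro i h0
    fin_cases i
    · exact one_ne_zero (congr_fun h0 4 : (![0, 0, 0, 0, 1] : Fin 5 → ℂ) 4 = 0)
    · exact one_ne_zero (congr_fun h0 0 : (![1, 0, 0, 0, 0] : Fin 5 → ℂ) 0 = 0)
    · exact one_ne_zero (congr_fun h0 0 : (![1, 0, 1, 0, 0] : Fin 5 → ℂ) 0 = 0)
  choose r v hvh hvM hvp hspan using fun i => exists_spanning_family M (pt i)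
  -- the orbit families' ranges and their (prime, non-zero) vanishing ideals
  let R : Fin 3 → Set (M → ℂ) := fun i =>
    Set.range (fun x : ((Fin 5 × Fin 5) ⊕ Fin (r i)) → ℂ => fun m : M =>
      MvPolynomial.aeval x (coeff m.1.1 (linSubst (Fin 5) (MvPolynomial (((Fin 5 × Fin 5)) ⊕ Fin (r i)) ℂ)
        (Matrix.of fun k l => if γ k = γ l then X (Sum.inl (k, l)) else 0)
        (∑ t, (X (Sum.inr t) : MvPolynomial (((Fin 5 × Fin 5)) ⊕ Fin (r i)) ℂ) •
          MvPolynomial.map (C : ℂ →+* MvPolynomial (((Fin 5 × Fin 5)) ⊕ Fin (r i)) ℂ) (v i t)))))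
  have hRprime : ∀ i, (vanishingIdeal ℂ (R i)).IsPrime := fun i =>
    isPrime_vanishingIdeal_range_orbitFamily γ M (v i)
  have hDmem : ∀ i, killHom ℂ 3 d M Disc ∈ vanishingIdeal ℂ (R i) := fun i =>
    killHom_mem_vanishingIdeal_range_orbitFamily (γ := γ) (M := M) (v := v i) hd hM hV (hpt i) (hvh i) (hvM i) (hvp i)
  have hRne : ∀ i, vanishingIdeal ℂ (R i) ≠ ⊥ := fun i hbot => by
    have := hDmem i; rw [hbot] at this; exact hD0 ((Submodule.mem_bot _).mp this)
  -- membership in a range: an `M`-form singular at a point of the right type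
  have hmemR : ∀ (i : Fin 3) {f : MvPolynomial (Fin 5) ℂ}, f.IsHomogeneous d → IsSupportedOn 3 d M f →
      ∀ {z : Fin 5 → ℂ}, (∀ j, MvPolynomial.eval z (pderiv j f) = 0) →
      ∀ {N : Matrix (Fin 5) (Fin 5) ℂ}, N * Matrix.diagonal (fun l : Fin 5 => if (l : ℕ) < 2 then (-1 : ℂ) else 1) =
        Matrix.diagonal (fun l : Fin 5 => if (l : ℕ) < 2 then (-1 : ℂ) else 1) * N → IsUnit N.det → N *ᵥ z = pt i →
      (fun m' : M => coeff m'.1.1 f) ∈ R i := by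
    intro i f hf hfM z hfz N hN hNdet hNz
    rw [← hγD] at hN
    exact mem_range_orbitFamily_of_transit (γ := γ) (M := M) (v := v i) hM (hspan i) hf hfM hfz hN hNdet hNz
  -- every zero of `h` lies in one of the three closures
  have hsub : zeroLocus ℂ (Ideal.span {h}) ⊆ ⋃ i, zeroLocus ℂ (vanishingIdeal ℂ (R i)) := by
    intro a ha
    have hha : MvPolynomial.eval a h = 0 := by
      have := (mem_zeroLocus_iff.mp ha) h (Ideal.subset_span rfl)
      rwa [aeval_eq] at this
    have hDa : MvPolynomial.eval a (killHom ℂ 3 d M Disc) = 0 := by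
      obtain ⟨c, hc⟩ := hdvd; rw [hc, map_mul, hha, zero_mul]
    -- the form of `a` is singular
    set f := formOfCoeffs (fun m : DegIndex 3 d => if hm : m ∈ M then a ⟨m, hm⟩ else 0) with hfdef
    have hf : f.IsHomogeneous d := isHomogeneous_formOfCoeffs _
    have hfM : IsSupportedOn 3 d M f := isSupportedOn_formOfCoeffs_extend M a
    have hsing : ¬ SmoothHypersurface.IsNonsingularForm ℂ f := by
      have : (fun m : DegIndex 3 d => if hm : m ∈ M then a ⟨m, hm⟩ else 0) ∈ singularCoeffs 3 d := by
        rw [hV, ← eval_killHom]; exact hDa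
      exact (mem_singularCoeffs_iff _ _ _).mp this
    rw [SmoothHypersurface.isNonsingularForm_iff_forall_exists_eval_pderiv_ne_zero] at hsing
    push Not at hsing
    obtain ⟨z, hz, -, hdz⟩ := hsing
    have ha_eq : (fun m' : M => coeff m'.1.1 f) = a := coeffM_formOfCoeffs_extend M a
    -- dispatch on the type of `z`
    have key : ∃ i, a ∈ R i := by
      by_cases hPi : z 0 = 0 ∧ z 1 = 0
      · have h234 : z 2 ≠ 0 ∨ z 3 ≠ 0 ∨ z 4 ≠ 0 := by
          by_contra hc; push Not at hc
          apply hz; funext l; fin_cases l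
          · exact hPi.1
          · exact hPi.2
          · exact hc.1
          · exact hc.2.1
          · exact hc.2.2
        obtain ⟨N, hN, hNdet, hNz⟩ := exists_commute_mulVec_eq_pi z hPi.1 hPi.2 h234
        exact ⟨0, ha_eq ▸ hmemR 0 hf hfM hdz hN hNdet hNz⟩
      · have h01 : z 0 ≠ 0 ∨ z 1 ≠ 0 := by
          by_contra hc; push Not at hc; exact hPi hc
        by_cases hL : z 2 = 0 ∧ z 3 = 0 ∧ z 4 = 0
        · obtain ⟨N, hN, hNdet, hNz⟩ := exists_commute_mulVec_eq_line z h01 hL.1 hL.2.1 hL.2.2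
          exact ⟨1, ha_eq ▸ hmemR 1 hf hfM hdz hN hNdet hNz⟩
        · have h234 : z 2 ≠ 0 ∨ z 3 ≠ 0 ∨ z 4 ≠ 0 := by
            by_contra hc; push Not at hc; exact hL hc
          obtain ⟨N, hN, hNdet, hNz⟩ := exists_commute_mulVec_eq_free z h01 h234
          exact ⟨2, ha_eq ▸ hmemR 2 hf hfM hdz hN hNdet hNz⟩
    obtain ⟨i, hi⟩ := key
    exact Set.mem_iUnion.mpr ⟨i, zeroLocus_vanishingIdeal_le (R i) hi⟩
  -- prime avoidance: `(h)` is one of the three primes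
  obtain ⟨i, hi⟩ := SignSymmetricPowersMeridianPrimes.exists_span_singleton_eq_of_zeroLocus_subset hh
    (fun i => vanishingIdeal ℂ (R i)) hRprime hRne hsub
  have hhR : h ∈ vanishingIdeal ℂ (R i) := by rw [← hi]; exact Ideal.subset_span rfl
  -- the witnesses lie in the ranges (move by the identity matrix)
  have hone : (1 : Matrix (Fin 5) (Fin 5) ℂ) * Matrix.diagonal (fun l : Fin 5 => if (l : ℕ) < 2 then (-1 : ℂ) else 1) =
      Matrix.diagonal (fun l : Fin 5 => if (l : ℕ) < 2 then (-1 : ℂ) else 1) * 1 := by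
    rw [Matrix.one_mul, Matrix.mul_one]
  have hdet1 : IsUnit (1 : Matrix (Fin 5) (Fin 5) ℂ).det := by rw [det_one]; exact isUnit_one
  have hval : ∀ {f : MvPolynomial (Fin 5) ℂ}, f.IsHomogeneous d → IsSupportedOn 3 d M f →
      (∀ j, MvPolynomial.eval (pt i) (pderiv j f) = 0) →
      MvPolynomial.eval (fun m' : M => coeff m'.1.1 f) h = 0 := by
    intro f hf hfM hfp
    have hmem : (fun m' : M => coeff m'.1.1 f) ∈ R i := hmemR i hf hfM hfp hone hdet1 (Matrix.one_mulVec _)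
    have := (mem_vanishingIdeal_iff.mp hhR) _ hmem
    rwa [aeval_eq] at this
  fin_cases i
  · exact Or.inl (hval hf₁ hM₁ h₁)
  · exact Or.inr (Or.inl (hval hf₂ hM₂ h₂))
  · exact Or.inr (Or.inr (hval hf₃ hM₃ h₃))

end Summit.HodgeConjecture.HodgeConjecture.Theorems.SignSymmetricPowersGenCoverage

end
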